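import Literature.NumberTheory.LFunctions.SiegelZeroExceptionalPrimeSums
import Literature.NumberTheory.LFunctions.HeckeLandauPageLowerBound
import Literature.NumberTheory.LFunctions.ZetaMulMeanValue

/-!
# Route `PrimeLevelFamEdge` — TYPED IDEA DELTAS, deck 9a: COVERING LEMMAS for the split-prime
# discharges (cell ls-idea, lens-8 sixth wave offers (6.6)(b)/(c); KERNEL bookkeeping)

Literature-only imports (no deck-on-deck). Used by deck 9b
(`PrimeLevelFamEdgeIdeaDeltasSplitPrimesDischarge.lean`), which discharges the annex A-I8-5 shapes
`SplitHarmonicMassConfined` / `SplitLogMassSmall` of deck 3 §2‴ BY CITE from Tao–Teräväinen 2022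
Prop. 3.5 and Heath-Brown 1983 Lemma 3. Contents (all PROVED, standard axioms):

* `exists_quality_of_threeHalves` — in the (A)_{3/2}-world `Re L(1,χ)·(log D)^{3/2} ≤ 1` with `log D`
  beyond an absolute threshold, a real primitive `χ ≠ 1` has a Siegel zero `β = 1 − 1/(η log D)` of
  quality `η ≥ c₀√(log D) ≥ 10` (Tao–Teräväinen's Definition 1.4 normalisation) — from the tree's
  Hecke theorem (`exists_quality_of_norm_lOne_le`) and `‖L(1,χ)‖ = Re L(1,χ)` for real `χ`;
* `band_index`, `splitSum_le_of_bands` — the primes `χ(p) = 1` in `[D^t, D^C]` are covered by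
  Tao–Teräväinen's bands `(D^{(1+t)/(2m)}, D^{(1+t)/(2(m−1))}]`, `2 ≤ m ≤ ⌊(1+t)/(2t)⌋ + 1`, and the tail
  `(D^{(1+t)/2}, D^{C'}]`, so their harmonic mass is at most `tail + M · (max band)`;
* `splitSum_le_rpow` — the trivial bound `Σ ≤ D^C`; small conversion helpers.

Nothing here mentions a named fact; nothing asserts that an exceptional character exists. «No
exceptional-zero theorem (no Landau–Siegel / Siegel-zero exclusion, no Theorem 1–2 of arXiv:2211.02515,
no repaired Margin232) is proved by ideation; typed ≠ proved.»
-/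

noncomputable section

namespace Summit.Parity.GeneralizedHardyLittlewood.Theorems.PrimeLevelFamEdgeIdeaDeltas

open Literature.NumberTheory.LFunctions

/-! ### Small helpers -/

/-- `log D ≥ 1` once `log D ≥ 2` — and then `D ≥ 3` as a natural number. [folklore] -/
theorem three_le_of_two_le_log {D : ℕ} (h : 2 ≤ Real.log (D : ℝ)) : 3 ≤ D := by
  by_contra hlt
  push Not at hlt
  have hD2 : (D : ℝ) ≤ 2 := by exact_mod_cast Nat.lt_succ_iff.mp hlt
  rcases Nat.eq_zero_or_pos D with h0 | hpos
  · subst h0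
    norm_num at h
  · have hDpos : (0 : ℝ) < D := by exact_mod_cast hpos
    have := Real.log_le_log hDpos hD2
    linarith [Real.log_two_lt_d9]

/-- For a real quadratic `χ ≠ 1`, `‖L(1,χ)‖ = Re L(1,χ)` (tree: `L(1,χ)` real and positive). [folklore] -/
theorem norm_lOne_eq_re {D : ℕ} [NeZero D] (χ : DirichletCharacter ℂ D) (hχ : χ ≠ 1)
    (hq : MulChar.IsQuadratic χ) : ‖χ.LFunction 1‖ = (χ.LFunction 1).re := by
  have hsq : χ ^ 2 = 1 := hq.sq_eq_one
  have hpos : 0 < (χ.LFunction 1).re := by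
    have h := ZetaMul.LOne_pos χ hχ hsq
    rwa [ZetaMul.LOne] at h
  have him : (χ.LFunction 1).im = 0 := by
    have := DirichletAbel.LFunction_ofReal_im_eq_zero χ hχ hsq (σ := 1) one_pos
    simpa using this
  rw [← Complex.re_add_im (χ.LFunction 1), him]
  simp [abs_of_pos hpos]

/-- `D^x < p ⟺ x log D < log p` and `p ≤ D^x ⟺ log p ≤ x log D` for `D > 0`, `p > 0`. [folklore] -/
theorem rpow_lt_natCast_iff {D : ℝ} (hD : 0 < D) {p : ℕ} (hp : 0 < p) (x : ℝ) :
    D ^ x < (p : ℝ) ↔ x * Real.log D < Real.log p := by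
  have hp' : (0 : ℝ) < p := by exact_mod_cast hp
  rw [Real.rpow_def_of_pos hD, ← Real.exp_log hp', Real.exp_lt_exp, Real.log_exp, mul_comm]

/-- `p ≤ D^x ⟺ log p ≤ x log D` for `D > 0`, `p > 0`. [folklore] -/
theorem natCast_le_rpow_iff {D : ℝ} (hD : 0 < D) {p : ℕ} (hp : 0 < p) (x : ℝ) :
    (p : ℝ) ≤ D ^ x ↔ Real.log p ≤ x * Real.log D := by
  have hp' : (0 : ℝ) < p := by exact_mod_cast hp
  rw [Real.rpow_def_of_pos hD, ← Real.exp_log hp', Real.exp_le_exp, Real.log_exp, mul_comm]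

/-- A sum of `1/p` over primes `p` with `χ(p) = 1` lying in `(⌊a⌋, ⌊b⌋]` is at most the tree's
`exceptionalPrimeHarmonicSum χ a b` (subset of non-negative terms). [folklore] -/
theorem sum_le_exceptionalPrimeHarmonicSum {D : ℕ} (χ : DirichletCharacter ℂ D)
    (s : Finset ℕ) (a b : ℝ)
    (hs : ∀ p ∈ s, p.Prime ∧ χ ((p : ℕ) : ZMod D) = 1 ∧ ⌊a⌋₊ < p ∧ p ≤ ⌊b⌋₊) :
    ∑ p ∈ s, 1 / (p : ℝ) ≤ exceptionalPrimeHarmonicSum χ a b := by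
  unfold exceptionalPrimeHarmonicSum
  apply Finset.sum_le_sum_of_subset_of_nonneg
  · intro p hp
    obtain ⟨h1, h2, h3, h4⟩ := hs p hp
    simp only [Finset.mem_filter, Finset.mem_Ioc]
    exact ⟨⟨h3, h4⟩, h1, h2⟩
  · intro p _ _
    positivity

/-- In the (A)_{3/2}-world with `log D ≥ T` large, a real primitive `χ ≠ 1` has a Siegel zero of
quality `η ≥ c₀ √(log D) ≥ 10` (tree `exists_quality_of_norm_lOne_le`, proved from Hecke).
[cite: MontgomeryVaughan2007, Thm. 11.4 (11.10)] -/
theorem exists_quality_of_threeHalves :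
    ∃ c₀ : ℝ, 0 < c₀ ∧ ∃ T : ℝ, 2 ≤ T ∧
      ∀ (D : ℕ) [NeZero D] (χ : DirichletCharacter ℂ D), χ ≠ 1 → MulChar.IsQuadratic χ →
        T ≤ Real.log D → (χ.LFunction 1).re * Real.log (D : ℝ) ^ (3 / 2 : ℝ) ≤ 1 →
          ∃ η : ℝ, 10 ≤ η ∧ c₀ * Real.sqrt (Real.log D) ≤ η ∧
            χ.LFunction ((1 - 1 / (η * Real.log D) : ℝ) : ℂ) = 0 := by
  obtain ⟨c₀, hc₀, L₀, hL₀, hQ⟩ := exists_quality_of_norm_lOne_le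
  refine ⟨c₀, hc₀, max 2 (max (1 / L₀ ^ 2) ((10 / c₀) ^ 2)), le_max_left _ _,
    fun D _ χ hχ hq hT hA ↦ ?_⟩
  have hT2 : 2 ≤ Real.log (D : ℝ) := le_trans (le_max_left _ _) hT
  have hTL : 1 / L₀ ^ 2 ≤ Real.log (D : ℝ) := le_trans ((le_max_left _ _).trans (le_max_right _ _)) hT
  have hTc : (10 / c₀) ^ 2 ≤ Real.log (D : ℝ) :=
    le_trans ((le_max_right _ _).trans (le_max_right _ _)) hT
  have hD3 : 3 ≤ D := three_le_of_two_le_log hT2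
  have hlogpos : 0 < Real.log (D : ℝ) := by linarith
  set ℓ : ℝ := Real.log (D : ℝ) with hℓ
  -- δ = ℓ^{-3/2}
  set δ : ℝ := ℓ ^ (-(3 / 2 : ℝ)) with hδ
  have hδpos : 0 < δ := Real.rpow_pos_of_pos hlogpos _
  have hℓ32 : 0 < ℓ ^ (3 / 2 : ℝ) := Real.rpow_pos_of_pos hlogpos _
  have hδinv : δ = (ℓ ^ (3 / 2 : ℝ))⁻¹ := by
    rw [hδ, Real.rpow_neg hlogpos.le]
  -- ‖L(1,χ)‖ ≤ δ
  have hnorm : ‖χ.LFunction 1‖ ≤ δ := by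
    rw [norm_lOne_eq_re χ hχ hq, hδinv, ← one_div, le_div_iff₀ hℓ32]
    exact hA
  -- δ·ℓ = ℓ^{-1/2} = 1/√ℓ ≤ L₀
  have hsqrtpos : 0 < Real.sqrt ℓ := Real.sqrt_pos.mpr hlogpos
  have hδℓ : δ * ℓ = 1 / Real.sqrt ℓ := by
    rw [hδ, ← Real.rpow_add_one hlogpos.ne', one_div, Real.sqrt_eq_rpow, ← Real.rpow_neg hlogpos.le]
    norm_num
  have hscale : δ * ℓ ≤ L₀ := by
    rw [hδℓ, div_le_iff₀ hsqrtpos]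
    -- 1 ≤ L₀ √ℓ  ⟸  1/L₀² ≤ ℓ
    have h1 : Real.sqrt (1 / L₀ ^ 2) ≤ Real.sqrt ℓ := Real.sqrt_le_sqrt hTL
    have h2 : Real.sqrt (1 / L₀ ^ 2) = 1 / L₀ := by
      rw [Real.sqrt_div' _ , Real.sqrt_one, Real.sqrt_sq hL₀.le]
      positivity
    rw [h2] at h1
    have : 1 ≤ L₀ * Real.sqrt ℓ := by
      have := mul_le_mul_of_nonneg_left h1 hL₀.le
      rwa [mul_one_div_cancel hL₀.ne'] at this
    linarith
  obtain ⟨η, hη0, hηge, hzero⟩ := hQ D χ hD3 hχ δ hδpos hscale hnorm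
  -- c₀/(δ ℓ) = c₀ √ℓ
  have hηge' : c₀ * Real.sqrt ℓ ≤ η := by
    rw [hδℓ] at hηge
    simpa [div_div_eq_mul_div] using hηge
  have hsqrt10 : 10 / c₀ ≤ Real.sqrt ℓ := by
    have := Real.sqrt_le_sqrt hTc
    rwa [Real.sqrt_sq (by positivity)] at this
  have h10 : 10 ≤ η := by
    have : 10 ≤ c₀ * Real.sqrt ℓ := by
      have := mul_le_mul_of_nonneg_left hsqrt10 hc₀.le
      rwa [mul_div_cancel₀ _ hc₀.ne'] at this
    linarith
  exact ⟨η, h10, hηge', hzero⟩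

/-! ### Covering the range [D^t, D^C] by Tao–Teräväinen bands -/

/-- **Band index.** For `D > 1`, `t > 0` and a prime `p` with `D^t ≤ p ≤ D^{(1+t)/2}`, the index
`m(p) = ⌊(1+t) log D/(2 log p)⌋ + 1` satisfies `2 ≤ m(p) ≤ ⌊(1+t)/(2t)⌋ + 1` and `p` lies in
Tao–Teräväinen's band `(D^{(1+t)/(2m)}, D^{(1+t)/(2(m−1))}]` (as integer parts). [folklore] -/
theorem band_index {D : ℝ} (hD : 1 < D) {t : ℝ} (ht : 0 < t) {p : ℕ} (hp : p.Prime)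
    (hpt : D ^ t ≤ (p : ℝ)) (hpa : (p : ℝ) ≤ D ^ ((1 + t) / 2)) :
    2 ≤ ⌊(1 + t) * Real.log D / (2 * Real.log p)⌋₊ + 1 ∧
      ⌊(1 + t) * Real.log D / (2 * Real.log p)⌋₊ + 1 ≤ ⌊(1 + t) / (2 * t)⌋₊ + 1 ∧
      ⌊D ^ ((1 + t) / (2 * ((⌊(1 + t) * Real.log D / (2 * Real.log p)⌋₊ + 1 : ℕ) : ℝ)))⌋₊ < p ∧
      p ≤ ⌊D ^ ((1 + t) / (2 * (((⌊(1 + t) * Real.log D / (2 * Real.log p)⌋₊ + 1 : ℕ) : ℝ) - 1)))⌋₊ := by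
  have hD0 : 0 < D := by linarith
  have hℓ : 0 < Real.log D := Real.log_pos hD
  have hp2 : (2 : ℝ) ≤ p := by exact_mod_cast hp.two_le
  have hlogp : 0 < Real.log p := Real.log_pos (by linarith)
  set μ : ℝ := (1 + t) * Real.log D / (2 * Real.log p) with hμdef
  have hμ1 : 1 ≤ μ := by
    have h1 : Real.log p ≤ (1 + t) / 2 * Real.log D := (natCast_le_rpow_iff hD0 hp.pos _).mp hpa
    rw [hμdef, le_div_iff₀ (by positivity)]
    linarith
  have hμ0 : 0 ≤ μ := by linarith
  have hμM : μ ≤ (1 + t) / (2 * t) := by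
    have h1 : t * Real.log D ≤ Real.log p := by
      have h := Real.log_le_log (Real.rpow_pos_of_pos hD0 t) hpt
      rwa [Real.log_rpow hD0] at h
    rw [hμdef, div_le_div_iff₀ (by positivity) (by positivity)]
    nlinarith
  obtain ⟨n, hn⟩ : ∃ n : ℕ, n = ⌊μ⌋₊ := ⟨_, rfl⟩
  rw [← hn]
  have hn1 : 1 ≤ n := by rw [hn]; exact Nat.le_floor (by exact_mod_cast hμ1)
  have hnle : (n : ℝ) ≤ μ := by rw [hn]; exact Nat.floor_le hμ0
  have hnlt : μ < n + 1 := by rw [hn]; exact Nat.lt_floor_add_one _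
  have hn1r : (1 : ℝ) ≤ n := by exact_mod_cast hn1
  refine ⟨by omega, ?_, ?_, ?_⟩
  · have : n ≤ ⌊(1 + t) / (2 * t)⌋₊ := by rw [hn]; exact Nat.floor_mono hμM
    omega
  · -- lower edge: D^{(1+t)/(2(n+1))} < p  ⟸  (1+t) log D < 2(n+1) log p  ⟸  μ < n+1
    apply (Nat.floor_lt (Real.rpow_nonneg hD0.le _)).mpr
    apply (rpow_lt_natCast_iff hD0 hp.pos _).mpr
    push_cast
    rw [hμdef, div_lt_iff₀ (by positivity)] at hnlt
    rw [div_mul_eq_mul_div, div_lt_iff₀ (by positivity)]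
    linarith
  · -- upper edge: p ≤ D^{(1+t)/(2n)}  ⟸  2 n log p ≤ (1+t) log D  ⟸  n ≤ μ
    apply Nat.le_floor
    apply (natCast_le_rpow_iff hD0 hp.pos _).mpr
    push_cast
    rw [add_sub_cancel_right]
    rw [hμdef, le_div_iff₀ (by positivity)] at hnle
    rw [div_mul_eq_mul_div, le_div_iff₀ (by positivity)]
    linarith

/-- **Covering the range by Tao–Teräväinen's bands.** For `D ≥ 2`, `0 < t`, `C ≤ C'`: if the tail sum `(D^{(1+t)/2}, D^{C'}]` is `≤ X₁` and every band sum, `2 ≤ m ≤ M`,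
`M = ⌊(1+t)/(2t)⌋ + 1`, is `≤ X₂` (with `X₂ ≥ 0`), then the harmonic mass of the primes `χ(p) = 1` in
`[D^t, D^C]` is `≤ X₁ + M·X₂`. [folklore] -/
theorem splitSum_le_of_bands {D : ℕ} (hD : 2 ≤ D) (χ : DirichletCharacter ℂ D)
    {t C C' X₁ X₂ : ℝ} (ht : 0 < t) (hCC' : C ≤ C') (hX₂ : 0 ≤ X₂)
    (htail : exceptionalPrimeHarmonicSum χ ((D : ℝ) ^ ((1 + t) / 2)) ((D : ℝ) ^ C') ≤ X₁)
    (hband : ∀ m : ℕ, 2 ≤ m → m ≤ ⌊(1 + t) / (2 * t)⌋₊ + 1 →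
      exceptionalPrimeHarmonicSum χ ((D : ℝ) ^ ((1 + t) / (2 * m)))
        ((D : ℝ) ^ ((1 + t) / (2 * (m - 1 : ℝ)))) ≤ X₂) :
    (∑ p ∈ (Finset.Icc ⌈(D : ℝ) ^ t⌉₊ ⌊(D : ℝ) ^ C⌋₊).filter
        (fun p : ℕ => p.Prime ∧ χ ((p : ℕ) : ZMod D) = 1), 1 / (p : ℝ)) ≤
      X₁ + ((⌊(1 + t) / (2 * t)⌋₊ + 1 : ℕ) : ℝ) * X₂ := by
  have hD0 : (0 : ℝ) < D := by exact_mod_cast (show 0 < D by omega)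
  have hD1 : (1 : ℝ) < D := by exact_mod_cast (show 1 < D by omega)
  obtain ⟨M, hM⟩ : ∃ M : ℕ, M = ⌊(1 + t) / (2 * t)⌋₊ + 1 := ⟨_, rfl⟩
  rw [← hM] at hband ⊢
  set F : Finset ℕ := (Finset.Icc ⌈(D : ℝ) ^ t⌉₊ ⌊(D : ℝ) ^ C⌋₊).filter
    (fun p : ℕ => p.Prime ∧ χ ((p : ℕ) : ZMod D) = 1) with hFdef
  set a₁ : ℝ := (D : ℝ) ^ ((1 + t) / 2) with ha₁def
  have ha₁pos : 0 < a₁ := Real.rpow_pos_of_pos hD0 _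
  have hmemF : ∀ p ∈ F, p.Prime ∧ χ ((p : ℕ) : ZMod D) = 1 ∧ (D : ℝ) ^ t ≤ p ∧ p ≤ ⌊(D : ℝ) ^ C⌋₊ := by
    intro p hp
    rw [hFdef, Finset.mem_filter, Finset.mem_Icc] at hp
    exact ⟨hp.2.1, hp.2.2, Nat.ceil_le.mp hp.1.1, hp.1.2⟩
  rw [← Finset.sum_filter_add_sum_filter_not F (fun p : ℕ => a₁ < (p : ℝ))]
  -- (i) tail
  have h1 : ∑ p ∈ F.filter (fun p : ℕ => a₁ < (p : ℝ)), 1 / (p : ℝ) ≤ X₁ := by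
    refine le_trans (sum_le_exceptionalPrimeHarmonicSum χ _ a₁ ((D : ℝ) ^ C') ?_) htail
    intro p hp
    rw [Finset.mem_filter] at hp
    obtain ⟨hpr, hχp, _, hpC⟩ := hmemF p hp.1
    refine ⟨hpr, hχp, (Nat.floor_lt ha₁pos.le).mpr hp.2, hpC.trans ?_⟩
    exact Nat.floor_mono (Real.rpow_le_rpow_of_exponent_le hD1.le hCC')
  -- (ii) bands, by fibres of the band index
  set g : ℕ → ℕ := fun p => ⌊(1 + t) * Real.log D / (2 * Real.log p)⌋₊ + 1 with hgdef
  set F₂ : Finset ℕ := F.filter (fun p : ℕ => ¬ a₁ < (p : ℝ)) with hF₂def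
  have hidx : ∀ p ∈ F₂, 2 ≤ g p ∧ g p ≤ M ∧
      ⌊(D : ℝ) ^ ((1 + t) / (2 * ((g p : ℕ) : ℝ)))⌋₊ < p ∧
      p ≤ ⌊(D : ℝ) ^ ((1 + t) / (2 * (((g p : ℕ) : ℝ) - 1)))⌋₊ := by
    intro p hp
    rw [hF₂def, Finset.mem_filter] at hp
    obtain ⟨hpr, _, hpt, _⟩ := hmemF p hp.1
    have hpa : (p : ℝ) ≤ a₁ := not_lt.mp hp.2
    have := band_index hD1 ht hpr hpt hpa
    rw [hM]
    exact this
  have hmaps : ∀ p ∈ F₂, g p ∈ Finset.Icc 2 M := by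
    intro p hp
    obtain ⟨h2, hM', _, _⟩ := hidx p hp
    exact Finset.mem_Icc.mpr ⟨h2, hM'⟩
  have h2 : ∑ p ∈ F₂, 1 / (p : ℝ) ≤ (M : ℝ) * X₂ := by
    rw [← Finset.sum_fiberwise_of_maps_to hmaps]
    have hfib : ∀ m ∈ Finset.Icc 2 M, ∑ p ∈ F₂ with g p = m, 1 / (p : ℝ) ≤ X₂ := by
      intro m hm
      obtain ⟨hm2, hmM⟩ := Finset.mem_Icc.mp hm
      refine le_trans (sum_le_exceptionalPrimeHarmonicSum χ _ _ _ ?_) (hband m hm2 hmM)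
      intro p hp
      rw [Finset.mem_filter] at hp
      obtain ⟨hpF₂, hgp⟩ := hp
      have hP := (Finset.mem_filter.mp (Finset.mem_filter.mp hpF₂).1).2
      obtain ⟨_, _, hlo, hhi⟩ := hidx p hpF₂
      rw [hgp] at hlo hhi
      exact ⟨hP.1, hP.2, hlo, hhi⟩
    calc ∑ m ∈ Finset.Icc 2 M, ∑ p ∈ F₂ with g p = m, 1 / (p : ℝ)
        ≤ ∑ m ∈ Finset.Icc 2 M, X₂ := Finset.sum_le_sum hfib
      _ = ((Finset.Icc 2 M).card : ℝ) * X₂ := by rw [Finset.sum_const, nsmul_eq_mul]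
      _ ≤ (M : ℝ) * X₂ := by
          apply mul_le_mul_of_nonneg_right _ hX₂
          have : (Finset.Icc 2 M).card ≤ M := by rw [Nat.card_Icc]; omega
          exact_mod_cast this
  exact add_le_add h1 h2

/-- The trivial bound: the harmonic mass of primes in `[D^t, D^C]` is at most `D^C`. [folklore] -/
theorem splitSum_le_rpow {D : ℕ} [NeZero D] (χ : DirichletCharacter ℂ D) (t C : ℝ) :
    (∑ p ∈ (Finset.Icc ⌈(D : ℝ) ^ t⌉₊ ⌊(D : ℝ) ^ C⌋₊).filter
        (fun p : ℕ => p.Prime ∧ χ ((p : ℕ) : ZMod D) = 1), 1 / (p : ℝ)) ≤ (D : ℝ) ^ C := by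
  have hD0 : (0 : ℝ) < D := by exact_mod_cast Nat.pos_of_ne_zero (NeZero.ne D)
  set F := (Finset.Icc ⌈(D : ℝ) ^ t⌉₊ ⌊(D : ℝ) ^ C⌋₊).filter
        (fun p : ℕ => p.Prime ∧ χ ((p : ℕ) : ZMod D) = 1) with hFdef
  calc ∑ p ∈ F, 1 / (p : ℝ) ≤ ∑ p ∈ F, (1 : ℝ) := by
        apply Finset.sum_le_sum
        intro p hp
        rw [hFdef, Finset.mem_filter] at hp
        have hp2 : (2 : ℝ) ≤ p := by exact_mod_cast hp.2.1.two_le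
        rw [div_le_one (by linarith)]
        linarith
    _ = (F.card : ℝ) := by simp
    _ ≤ (⌊(D : ℝ) ^ C⌋₊ : ℝ) := by
        have h1 : F.card ≤ (Finset.Icc ⌈(D : ℝ) ^ t⌉₊ ⌊(D : ℝ) ^ C⌋₊).card :=
          Finset.card_filter_le _ _
        have h2 : (Finset.Icc ⌈(D : ℝ) ^ t⌉₊ ⌊(D : ℝ) ^ C⌋₊).card ≤ ⌊(D : ℝ) ^ C⌋₊ := by
          rw [Nat.card_Icc]
          have : 1 ≤ ⌈(D : ℝ) ^ t⌉₊ := Nat.one_le_iff_ne_zero.mpr (by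
            rw [Ne, Nat.ceil_eq_zero, not_le]; exact Real.rpow_pos_of_pos hD0 _)
          omega
        exact_mod_cast h1.trans h2
    _ ≤ (D : ℝ) ^ C := Nat.floor_le (Real.rpow_nonneg hD0.le _)

end Summit.Parity.GeneralizedHardyLittlewood.Theorems.PrimeLevelFamEdgeIdeaDeltas
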